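import Literature.AnabelianGeometry.SemiGraphs.ArithLevelKernelInner
import Literature.AnabelianGeometry.SemiGraphs.ArithLevelKernelBaseAction
import Literature.AnabelianGeometry.SemiGraphs.ArithVertGpNormalizerDictionary
import HarnessLib

/-!
# [SemiAnbd] Thm 5.4 (i) p. 66, producer T54-B: the binder `hU` of the hcof-free (AI4″) producer is a
# THEOREM of the tower data — NO residual (neither «hfaith-arith», nor `hcof`, nor «hUρ», nor `hR`)

Mochizuki, *Semi-graphs of anabelioids*, Publ. RIMS **42** (2006), proof of Thm 3.7 (iii) p. 41, §5 p. 65,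
Thm 5.4 (i) p. 66 [cite: MochizukiSemiAnbd2006, Thm 5.4 (i) p.66].

PROOF-ONLY (abc-iut cell, row T54-B, gap row G-w4d085-1 — final disposition; seat abc-iut-w4-d085 gen 4).
`map_aug_le_conj_of_levelDict_modKernel` (ArithBranchPairAugModKernel.lean) asks, besides abc-iut-w4-d059's
E-level inputs, for `hUclosed` (a theorem at the tempered topology, ArithLevelCofinalityOuterAction v2) and

  `hU : ∀ a, (∀ n, a ∈ aug (ker (arithAct (L n)))) → ∃ z ∈ Π_{v₀}, aug z = a ∧ ∀ n, arithAct (L n) z = 1`.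

Here `hU` is PROVED from tower data ALONE (no residual finiteness, no estrangement test, no faithfulness):
by Theorem C of ArithLevelKernelInner.lean (`exists_lift_arithAct_eq_one_of_mem_iInf_map_ker`) `a` has ONE
lift `e′` acting trivially at every finite level; its vertex conjugator `k` (`Φ_{e′}(H_{v₀}) = k H_{v₀} k⁻¹`)
then lies in `L n · H_{v₀}` for EVERY `n` (it fixes the vertex `H_{v₀}·1·L n`), hence — `H_{v₀}` compact,
`L n` closed antitone, a convergent subsequence — `k = r·h` with `r ∈ ⋂ₙ L n`, `h ∈ H_{v₀}`
(`exists_mem_iInf_mul_of_forall_mem_mul`); and `z := ι(r)⁻¹ · e′` still acts trivially at every level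
(`r ∈ L n` acts trivially) and NORMALISES `H_{v₀}` through `Φ` with vertex conjugator `1`
(`exists_lift_isVConj_one_arithAct_eq_one`).  At the outer model, abc-iut-w4-d059's dictionary
`mem_arithVertGp_of_isVConj_one` (ArithVertGpNormalizerDictionary.lean, p438526) turns this into membership
in `Π^temp_{𝔊,v₀} = arithVertGp Rc ι v₀` — the binder `hU` VERBATIM (`hU_arithVertGp_outerAction`).

Consequently the (AI4″) field `stabBranchPairAug` is produced along modKernel with NO hypothesis beyond the
structural tower data shared with abc-iut-w4-d059's `levelDict′` route (the binder `hcof` ⟺ «hfaith-arith»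
of that route, which forces a faithful joint action — ArithLevelCofinalityOuterAction.lean — is gone).
No definition, no new named fact; no side taken on [IUTchIII] Cor 3.12.
-/

namespace Literature.AnabelianGeometry.SemiGraphs

open CategoryTheory Topology Filter
open scoped Pointwise

universe u v w

namespace SemiGraph

namespace SubgroupPresentation

variable {𝔾 : SemiGraph.{u}} {Γ : Type u} [Group Γ] [TopologicalSpace Γ] [IsTopologicalGroup Γ]
  (P : SubgroupPresentation 𝔾 Γ)

/-- **`⋂ₙ L n · H = (⋂ₙ L n) · H` for compact `H`** (closed antitone `L n`, first countable group): an
element lying in `L n · H` for every `n` is `r · h` with `r ∈ ⋂ₙ L n`, `h ∈ H` (convergent subsequence of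
the `H`-parts). [cite: MochizukiSemiAnbd2006, Thm 3.7 (iii) p.41] -/
theorem exists_mem_iInf_mul_of_forall_mem_mul [FirstCountableTopology Γ] (L : ℕ → Subgroup Γ)
    (hLclosed : ∀ n, IsClosed (L n : Set Γ)) (hLanti : Antitone L) (H : Subgroup Γ)
    (hHc : IsCompact (H : Set Γ)) {k : Γ} (hk : ∀ n, k ∈ (L n : Set Γ) * (H : Set Γ)) :
    ∃ r h : Γ, (∀ n, r ∈ L n) ∧ h ∈ H ∧ k = r * h := by
  choose l hl h hh hlh using fun n => Set.mem_mul.mp (hk n)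
  obtain ⟨h₀, hh₀, φ, hφ, hlim⟩ := hHc.tendsto_subseq hh
  refine ⟨k * h₀⁻¹, h₀, fun m => ?_, hh₀, by group⟩
  -- `l (φ j) = k * (h (φ j))⁻¹ → k * h₀⁻¹`, eventually inside the closed `L m`
  have hconv : Tendsto (fun j => k * (h (φ j))⁻¹) atTop (𝓝 (k * h₀⁻¹)) :=
    tendsto_const_nhds.mul hlim.inv
  refine (hLclosed m).mem_of_tendsto hconv ?_
  refine (eventually_ge_atTop m).mono fun j hj => ?_
  have hj' : m ≤ φ j := hj.trans (StrictMono.id_le hφ j)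
  have : k * (h (φ j))⁻¹ = l (φ j) := by rw [← hlh (φ j)]; group
  rw [this]
  exact hLanti hj' (hl (φ j))

section Lift

variable {E : Type v} [Group E] {Φ : E →* MulAut Γ} {σ : E →* Aut 𝔾} (hP : P.IsArithCompatible Φ σ)
  (ι : Γ →* E) (hιΦ : ∀ g : Γ, Φ (ι g) = MulAut.conj g) (hισ : ∀ g : Γ, σ (ι g) = 1)
  {PA : Type w} [Group PA] (aug : E →* PA)
  (hex : ∀ e e' : E, aug e = aug e' → ∃ g : Γ, e' = e * ι g) (haugι : ∀ g : Γ, aug (ι g) = 1)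
  (K : ℕ → Subgroup Γ) [∀ m, (K m).Normal] (hK : ∀ ⦃i j : ℕ⦄, i ≤ j → K j ≤ K i)
  (hKst : ∀ (m : ℕ) (e : E) (x : Γ), x ∈ K m → Φ e x ∈ K m)
  (hHK : ∀ (w : 𝔾.Vertex) (x : Γ), (∀ j, x ∈ (P.H w : Set Γ) * (K j : Set Γ)) → x ∈ P.H w)
  (hlift : ∀ (w : 𝔾.Vertex) (y : ℕ → Γ),
    (∀ ⦃i j : ℕ⦄, i ≤ j → DoubleCoset.mk (P.H w) (K i) (y j) = DoubleCoset.mk (P.H w) (K i) (y i)) →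
    ∃ z : Γ, ∀ j, DoubleCoset.mk (P.H w) (K j) z = DoubleCoset.mk (P.H w) (K j) (y j))
  (L : ℕ → Subgroup Γ) [∀ n, (L n).Normal]
  (hLst : ∀ (n : ℕ) (e : E) (x : Γ), x ∈ L n → Φ e x ∈ L n)
  (hKL : ∀ n, K n ≤ L n) (hLopen : ∀ n, IsOpen (L n : Set Γ)) (hLanti : Antitone L)
  (v₀ : 𝔾.Vertex) (hHc : IsCompact (P.H v₀ : Set Γ))

include hιΦ hισ hex haugι hK hKst hHK hlift hKL hLopen hLanti hHc

/-- **The binder `hU` as a theorem (E-level form).** Every `a ∈ U_∞ = ⋂ₙ aug (ker (arithAct (L n)))`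
has a lift `z` acting trivially on EVERY finite level, trivially on the base, and NORMALISING `H_{v₀}`
through `Φ` with vertex conjugator `1` — from tower data alone (Theorem C of ArithLevelKernelInner.lean,
then `k ∈ ⋂ₙ L n · H_{v₀} = (⋂ₙ L n)·H_{v₀}` for the vertex conjugator and the twist `z := ι(r)⁻¹ e′`).
[cite: MochizukiSemiAnbd2006, Thm 5.4 (i) p.66] -/
theorem exists_lift_isVConj_one_arithAct_eq_one [FirstCountableTopology Γ] {a : PA}
    (ha : ∀ n, a ∈ ((P.arithAct hP (L n) (hLst n)).ker).map aug) :
    ∃ z : E, aug z = a ∧ σ z = 1 ∧ P.IsVConj Φ σ z v₀ 1 ∧ ∀ n, P.arithAct hP (L n) (hLst n) z = 1 := by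
  obtain ⟨e, hea, he⟩ := P.exists_lift_arithAct_eq_one_of_mem_iInf_map_ker hP ι hιΦ hισ aug hex haugι K
    hK hKst hHK hlift L hLst hKL hLopen hLanti v₀ hHc ha
  have hσe : σ e = 1 := P.σ_eq_one_of_arithAct_eq_one hP (L 0) (hLst 0) (he 0)
  have hσv : (σ e).hom.vertexMap v₀ = v₀ := by rw [hσe]; rfl
  -- the vertex conjugator of `e` at `v₀` lies in `L n · H_{v₀}` for every `n`
  have hk := P.isVConj_vConj hP e v₀
  set k := P.vConj hP e v₀ with hkdef
  have hkmem : ∀ n, k ∈ (L n : Set Γ) * (P.H v₀ : Set Γ) := by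
    intro n
    have hfix : (P.arithAct hP (L n) (hLst n) e).hom.vertexMap (P.vMk (L n) v₀ 1) = P.vMk (L n) v₀ 1 := by
      rw [he n]; rfl
    rw [P.arithAct_vertexMap_vMk hP (L n) (hLst n) hk 1, hσv, map_one, mul_one] at hfix
    have hmk : DoubleCoset.mk (P.H v₀) (L n) k⁻¹ = DoubleCoset.mk (P.H v₀) (L n) 1 :=
      eq_of_heq (Sigma.mk.inj_iff.mp hfix).2
    obtain ⟨h, hh, l, hl, h1⟩ := (DoubleCoset.eq _ _ _ _).mp hmk
    -- `1 = h * k⁻¹ * l`, so `k = l * h`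
    have hk' : k = l * h := by
      calc k = (h⁻¹ * (h * k⁻¹ * l) * l⁻¹)⁻¹ := by group
        _ = (h⁻¹ * 1 * l⁻¹)⁻¹ := by rw [← h1]
        _ = l * h := by group
    exact Set.mem_mul.mpr ⟨l, hl, h, hh, hk'.symm⟩
  -- `k = r * h` with `r ∈ ⋂ₙ L n`, `h ∈ H_{v₀}`
  obtain ⟨r, h, hr, hh, hkrh⟩ := exists_mem_iInf_mul_of_forall_mem_mul L
    (fun n => (L n).isClosed_of_isOpen (hLopen n)) hLanti (P.H v₀) hHc hkmem
  -- the twisted lift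
  refine ⟨ι r⁻¹ * e, by rw [map_mul, haugι, one_mul, hea], by rw [map_mul, hισ, one_mul, hσe], ?_, fun n => ?_⟩
  · -- vertex conjugator `1`: `Φ_z x = r⁻¹ Φ_e(x) r`, and `x ∈ H ↔ k⁻¹ Φ_e x k ∈ H` with `k = r h`
    intro x
    have hx := hk x
    rw [hσv] at hx
    have hσz : ((σ (ι r⁻¹ * e)).hom.vertexMap v₀) = v₀ := by rw [map_mul, hισ, one_mul, hσv]
    rw [hσz, inv_one, one_mul, mul_one, map_mul, hιΦ, MulAut.mul_apply, MulAut.conj_apply, inv_inv, hx,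
      hkrh]
    -- `(r h)⁻¹ y (r h) ∈ H ↔ r⁻¹ y r ∈ H`
    constructor
    · intro hy
      have : r⁻¹ * Φ e x * r = h * ((r * h)⁻¹ * Φ e x * (r * h)) * h⁻¹ := by group
      rw [this]
      exact (P.H v₀).mul_mem ((P.H v₀).mul_mem hh hy) ((P.H v₀).inv_mem hh)
    · intro hy
      have : (r * h)⁻¹ * Φ e x * (r * h) = h⁻¹ * (r⁻¹ * Φ e x * r) * h := by group
      rw [this]
      exact (P.H v₀).mul_mem ((P.H v₀).mul_mem ((P.H v₀).inv_mem hh) hy) hh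
  · rw [map_mul, he n, mul_one, P.arithAct_eq_deckAct_of_inner hP (L n) (hLst n) (hιΦ r⁻¹) (hισ _)]
    exact P.deckAct_eq_one_of_mem (L n) ((L n).inv_mem (hr n))

end Lift

end SubgroupPresentation

end SemiGraph

/-! ### At the outer model: the binder `hU` of `map_aug_le_conj_of_levelDict_modKernel`, VERBATIM -/

namespace ProfiniteSemiGraph

open Literature.AnabelianGeometry.EtaleTheta

variable {𝒢 : ProfiniteSemiGraph.{u}} (c : TemperedPiChart 𝒢)
  {PA : Type u} [Group PA] (ρ : PA →* TopOut c.G) (baseAct : PA →* Aut 𝒢.graph)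
  (P : SemiGraph.SubgroupPresentation 𝒢.graph c.G)
  (hP : P.IsArithCompatible
    (((contMulAut c.G).subtype.comp (MonoidHom.fst (contMulAut c.G) PA)).comp
      (outerSemidirectProduct ρ).subtype)
    (baseAct.comp (outerSemidirectProductSnd ρ)))

/-- **The binder `hU` of the hcof-free (AI4″) producer at `π₁^temp(𝒢) ⋊^out Π_A`, as a THEOREM of the
tower data** (exactness `hex`; TREE levels `K` with `hHK`/`hlift`; open antitone FINITE levels `L ⊇ K`;
`H_{v₀}` compact; `π₁^temp(𝒢)` first countable; representatives with `Rc.Hv = P.H`): every `a ∈ U_∞` is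
`aug z` for some `z ∈ arithVertGp Rc ι v₀` acting trivially at every finite level.  No residual
hypothesis. [cite: MochizukiSemiAnbd2006, Thm 5.4 (i) p.66] -/
theorem hU_arithVertGp_outerAction [IsTopologicalGroup c.G] [FirstCountableTopology c.G]
    (hex : (toOuterSemidirectProduct ρ).range = (outerSemidirectProductSnd ρ).ker)
    (K : ℕ → Subgroup c.G) [∀ m, (K m).Normal] (hK : ∀ ⦃i j : ℕ⦄, i ≤ j → K j ≤ K i)
    (hKst : ∀ (m : ℕ) (e : outerSemidirectProduct ρ) (x : c.G), x ∈ K m →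
      (((contMulAut c.G).subtype.comp (MonoidHom.fst (contMulAut c.G) PA)).comp
        (outerSemidirectProduct ρ).subtype) e x ∈ K m)
    (hHK : ∀ (w : 𝒢.graph.Vertex) (x : c.G), (∀ j, x ∈ (P.H w : Set c.G) * (K j : Set c.G)) → x ∈ P.H w)
    (hlift : ∀ (w : 𝒢.graph.Vertex) (y : ℕ → c.G),
      (∀ ⦃i j : ℕ⦄, i ≤ j → DoubleCoset.mk (P.H w) (K i) (y j) = DoubleCoset.mk (P.H w) (K i) (y i)) →
      ∃ z : c.G, ∀ j, DoubleCoset.mk (P.H w) (K j) z = DoubleCoset.mk (P.H w) (K j) (y j))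
    (L : ℕ → Subgroup c.G) [∀ n, (L n).Normal]
    (hLst : ∀ (n : ℕ) (e : outerSemidirectProduct ρ) (x : c.G), x ∈ L n →
      (((contMulAut c.G).subtype.comp (MonoidHom.fst (contMulAut c.G) PA)).comp
        (outerSemidirectProduct ρ).subtype) e x ∈ L n)
    (hKL : ∀ n, K n ≤ L n) (hLopen : ∀ n, IsOpen (L n : Set c.G)) (hLanti : Antitone L)
    (v₀ : 𝒢.graph.Vertex) (hHc : IsCompact (P.H v₀ : Set c.G))
    (Rc : ChartRepresentatives c) (hRcV : ∀ v, Rc.Hv v = P.H v)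
    {a : PA} (ha : ∀ n, a ∈ ((P.arithAct hP (L n) (hLst n)).ker).map (outerSemidirectProductSnd ρ)) :
    ∃ z ∈ arithVertGp Rc (toOuterSemidirectProduct ρ) v₀,
      outerSemidirectProductSnd ρ z = a ∧ ∀ n, P.arithAct hP (L n) (hLst n) z = 1 := by
  have hιΦ : ∀ g : c.G, (((contMulAut c.G).subtype.comp (MonoidHom.fst (contMulAut c.G) PA)).comp
      (outerSemidirectProduct ρ).subtype) (toOuterSemidirectProduct ρ g) = MulAut.conj g := fun _ => rfl
  have haugι : ∀ g : c.G, outerSemidirectProductSnd ρ (toOuterSemidirectProduct ρ g) = 1 := fun g =>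
    (MonoidHom.mem_ker).mp (hex ▸ ⟨g, rfl⟩)
  have hισ : ∀ g : c.G, (baseAct.comp (outerSemidirectProductSnd ρ)) (toOuterSemidirectProduct ρ g) = 1 :=
    fun g => by rw [MonoidHom.comp_apply, haugι, map_one]
  have hex' : ∀ e e' : outerSemidirectProduct ρ, outerSemidirectProductSnd ρ e = outerSemidirectProductSnd ρ e' →
      ∃ g : c.G, e' = e * toOuterSemidirectProduct ρ g := by
    intro e e' h
    have hmem : e⁻¹ * e' ∈ (outerSemidirectProductSnd ρ).ker := by
      rw [MonoidHom.mem_ker, map_mul, map_inv, h, inv_mul_cancel]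
    rw [← hex] at hmem
    obtain ⟨g, hg⟩ := hmem
    exact ⟨g, by rw [hg, mul_inv_cancel_left]⟩
  obtain ⟨z, hza, hσz, hV, hz⟩ := P.exists_lift_isVConj_one_arithAct_eq_one hP (toOuterSemidirectProduct ρ)
    hιΦ hισ (outerSemidirectProductSnd ρ) hex' haugι K hK hKst hHK hlift L hLst hKL hLopen hLanti v₀ hHc ha
  have hσv : ((baseAct.comp (outerSemidirectProductSnd ρ)) z).hom.vertexMap v₀ = v₀ := by rw [hσz]; rfl
  exact ⟨z, mem_arithVertGp_of_isVConj_one c P (toOuterSemidirectProduct ρ)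
    (fun e y => conj_toOuterSemidirectProduct ρ e y) Rc hRcV hσv hV, hza, hz⟩

end ProfiniteSemiGraph

end Literature.AnabelianGeometry.SemiGraphs
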